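import Literature.MathematicalPhysics.QuantumLattice.HubbardTTPrimeKinematicRowsAllFillings
import Literature.MathematicalPhysics.QuantumLattice.HubbardHoppingBondNormSharp
import HarnessLib

/-!
# The hopping interaction along an arbitrary lattice vector `v`: dictionary with the `t`, `t'`, `t''`
# interactions, pullback along injective additive lattice maps, and the kinematic PAIR rows
# `|K_v(ω) + K_w(ω)| ≤ 16/π²` (knight-move `t‴` rows as the new instance)

Topic `Literature/MathematicalPhysics/QuantumLattice` (family `hubbard`; §1–§6 general dimension `d`).
Companion of `InfVolFermionState.lean` §6 (`hubbardFermionInteraction`), `HubbardNNNHoppingInteraction`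
(`diagHoppingFermionInteraction`), `HubbardThirdNeighbourHoppingInteraction` (`axialRange2HoppingFermionInteraction`),
`InfVolFermionStateLatticeMapPullback` (`InfVolFermionState.mapAct`, the pulled-back state `ω ∘ Γ_f`) and
`TIGroundEnergyDensityCouplingFamilies` (`FermionInteraction.linearFamily`). Written for stage S2
(CERTIFIER-FAMILIES, «families of models») of the Hubbard material-oracle programme: a downfolded one-band
Hamiltonian carries hoppings `t(R)` along MANY lattice vectors `R` (Pavarini et al. 2001 eq. (1): `t, t', t''`;
the Wannier fits of the S1 router also print `t‴` and longer ranges, booked there as the INFL-TRUNC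
inflation), while the tree defines the nearest-neighbour, diagonal and axial range-2 interactions one by one
(`HubbardHoppingRangeFermiSeaResidual`: «the thermodynamic-limit statement for a three-graph family would
need that family's Hamiltonian, which the tree does not define»). This file supplies the missing atom — ONE
interaction per unoriented bond class `±v` — and the two structural facts every transport rule needs about
it: how it moves under lattice maps, and its class-wide kinematic bracket.

* §1 bond pairs `{x, x + v}` (`v ≠ 0`): cardinality, `{y, y+u} = {x, x+v} ⇒ u = ±v`, place in the range
  boxes `thicken {0} R` (symmetric under `v ↦ -v`).
* §2 **`vectorHoppingFermionInteraction d v t`**: `Φ_v{x, x+v} = −t Σ_σ (c†_{xσ} c_{x+v,σ} + h.c.)`, `0` on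
  every other set; even, Hermitian, linear in `t` (`_smul_apply`, `_add_apply`, `_zero_apply`), the bond
  term (`_apply_pair`), vanishing lemmas (`_apply_eq_zero`, `_apply_singleton`), and `Φ_{-v} = Φ_v`
  (`vectorHoppingFermionInteraction_neg`).
* §3 the mean-energy observable `E_{Φ_v} = ½Γ(Φ_v{0,v}) + ½Γ(Φ_v{−v,0})` at any range parameter whose box
  contains `v` (`vectorHoppingFermionInteraction_meanEnergyObs`), the sharp bond norm `‖Γ(Φ_v{x,x+v})‖ ≤ 2|t|`
  (Koma–Tasaki, via the tree's `norm_hoppingTerm_le_two_mul`), `‖E_{Φ_v}‖ ≤ 2|t|`, and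
  `|K_v^{t}(ω)| ≤ 2|t|` for EVERY state (`abs_meanEnergy_vectorHopping_le`; `K_v(ω) := e_{Φ_v^{1}}(ω)` is the
  `v`-bond energy per site).
* §4 DICTIONARY (term by term, `FermionInteraction.ext`-ready): `Φ^{t,U} = Φ^{0,U} + Σ_i Φ_{e_i}^{t}`
  (`hubbardFermionInteraction_apply_eq_onSite_add_sum_vectorHopping`, linear-family form
  `hubbardFermionInteraction_eq_linearFamily_vectorHopping`), `Φ'^{t'} = Σ_s Φ_{e₁±e₂}^{t'}`,
  `Φ''^{t''} = Σ_i Φ_{2e_i}^{t''}`; hence `K₁ = Σ_i K_{e_i}`, `K₂ = K_{(1,1)} + K_{(1,−1)}`, `K₃ = Σ_i K_{2e_i}`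
  for every state (`meanEnergy_nnHop/diagHop/axialRange2Hopping_eq_sum_vectorHopping`). The combinatorial core
  is `sum_ite_eq_add_and`: over an injective family of jumps at most one fits a given ordered pair.
* §5 PULLBACK: a `v`-bond term is carried onto a `w`-bond term by any embeddings matching the endpoints
  (`fermionEmbed_vectorHopping_pair_eq`), hence for an injective ADDITIVE `f : ℤ^d → ℤ^{d'}`
  **`K_v^{t}(ω ∘ Γ_f) = K_{f(v)}^{t}(ω)`** (`InfVolFermionState.meanEnergy_vectorHopping_mapAct`) — the general
  form of the doubling (`K₁ ↦ K₃`) and checkerboard (`K₁ ↦ K₂`) bond identities of the tree.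
* §6 PAIR ROWS: `latticePairMap v w : ℤ² →+ ℤ^{d'}`, `x ↦ x₀v + x₁w` (`e₀ ↦ v`, `e₁ ↦ w`; injective iff `v, w` are
  `ℤ`-independent, on `ℤ²` iff `det(v,w) ≠ 0`, `pairMap_injective_of_det_ne_zero`); `K₁(ω ∘ Γ_{latticePairMap}) =
  K_v(ω) + K_w(ω)`; and **for every translation-invariant `ω` on `ℤ^{d'}` (any filling) and every injective
  pair: `|K_v(ω) + K_w(ω)| ≤ 16/π²`** (`IsTranslationInvariant.abs_meanEnergy_vectorHopping_add_le`) — the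
  pulled-back state is translation invariant on `ℤ²` and the class-wide half-filled-band row
  `abs_meanEnergy_nnHop_le_of_any_density` applies to it.
* §7 (`ℤ²`) instances: the diagonal pair (the tree's `K₂` row re-derived), and the NEW knight-move rows for the
  `t‴` classes `knightVec = ((2,1), (1,2), (2,−1), (1,−2))`: `|K_{(2,1)} + K_{(1,2)}| ≤ 16/π²`,
  `|K_{(2,−1)} + K_{(1,−2)}| ≤ 16/π²`, so `|Σ_k K_{knight k}(ω)| ≤ 32/π² < 3.243` for every translation-invariant
  state (vs `8` from the norm): a `t‴`-truncation moves any translation-invariant energy density by at most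
  `3.243 |t‴|` (La₂CuO₄ band: `t‴/t = 0.055` ⇒ `0.178 t`), the kinematic price of the router's INFL-TRUNC.

Everything is PROVED; two definitions with bodies (`vectorHoppingFermionInteraction`, `latticePairMap`; plus the
table `knightVec`), no named fact, no number of record, no `sorry`. HONEST SCOPE: kinematic constants only
(one-body, filling-blind); a single-direction class-wide row sharper than the norm (`4/π` per direction, the
one-dimensional Fermi sea) is NOT claimed — it needs a thermodynamic-limit bathtub bound for the `x`-only
band that the tree does not hold; certified `K_v` words at an anchor remain the way to usable truncation
losses; nothing here bears on order / pairing words.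

## Mathlib / tree search

REUSED: `FermionInteraction.ext`, `linearFamily`, `linearFamily_apply`, `InfVolFermionState.meanEnergy_linearFamily`
(`TIGroundEnergyDensityCouplingFamilies`); `InfVolFermionState.mapAct`, `mapAct_expect`, `IsTranslationInvariant.mapAct`,
`PolySite.mapEmb(_pt)`, `mapSet`, `mem_thicken_zero_iff`, `fermionEmbed_cAt_of_apply_eq` (`InfVolFermionStateLatticeMapPullback`);
`FermionInteraction.meanEnergyObs_eq_sum`, `unitVec_mem_thicken_one`, `uvec_injective`, `uvec_ne_zero`
(`HubbardFermionInteractionTerms`, `ZdBoxesLines`); `diagVec(_injective, _mem_thicken_one)`, `diagHoppingFermionInteraction_smul`,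
`FermionInteraction.meanEnergyObs_of_smul`, `hubbardFermionInteraction_smul` (`HubbardNNNHoppingInteraction`,
`HubbardTTPrimeMeanEnergySupergradient`); `axial2Vec(_injective)`, `axialRange2HoppingFermionInteraction_smul_apply`;
`norm_hoppingTerm_le_two_mul` (`HubbardHoppingBondNormSharp`); `InfVolFermionState.abs_meanEnergy_le_norm`
(`TIGroundEnergyDensityResponse`); `expect_fermionEmbed_incl_eq`, `fermionEmbed_fermionEmbed` (`InfVolFermionState`);
`IsTranslationInvariant.abs_meanEnergy_nnHop_le_of_any_density`, `hubbardTTPrimeFermionInteraction_tPrime_zero`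
(`HubbardTTPrimeKinematicRowsAllFillings`). `lean search 'vectorHopping|bondHopping|hoppingAlong|generalHopping|latticePairMap'
--decl`: only the finite-cluster coefficient table `bondHopping` (`ClusterPairBosonCouplings`), unrelated.

## References

* E. Pavarini, I. Dasgupta, T. Saha-Dasgupta, O. Jepsen, O. K. Andersen, PRL 87 (2001) 047003, eq. (1)
  (the one-band dispersion with `t, t', t''`). [cite: PavariniEtAl2001, eq. (1)]
* H. Araki, H. Moriya, Rev. Math. Phys. 15 (2003) 93, §4.1 (local CAR algebras, site maps `a_i ↦ a_{φ(i)}`),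
  §5.1 (even finite-range potentials). [cite: ArakiMoriya2003, §4.1]
* O. Bratteli, D. W. Robinson, *OAQSM 1* (1987), §4.3.1 (states composed with morphisms), Prop. 2.3.11
  (states are contractive). [cite: BratteliRobinsonI1987, §4.3.1]
* O. Bratteli, A. Kishimoto, D. W. Robinson, CMP 64 (1978) 41, §3 (mean energy functional).
  [cite: BratteliKishimotoRobinson1978, §3 (mean energy functional)]
* T. Koma, H. Tasaki, PRL 68 (1992) 3248, remark after eq. (11) (the hopping-term norm). [cite: KomaTasakiPRL1992, eq. (11) remark]
* E. H. Lieb, M. Loss, Duke Math. J. 71 (1993) 337, §8 Thm. 8.2 (bathtub; the constant `16/π²`).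
  [cite: LiebLoss1993, §8, Theorem 8.2]
-/

noncomputable section

namespace Literature.MathematicalPhysics.QuantumLattice

open Matrix Finset HubbardWave0 Literature.Probability.LatticeModels ThermodynamicLimit
open scoped ComplexOrder BigOperators

variable {d d' : ℕ}

/-! ### §1. Lattice vectors: bond pairs and their place in the range boxes -/

/-- `x ≠ x + v` for a nonzero jump `v` (the two ends of a bond are distinct sites). [cite: PavariniEtAl2001, eq. (1)] -/
theorem self_ne_add_of_ne_zero (x : Site d) {v : Site d} (hv : v ≠ 0) : x ≠ x + v := fun h =>
  hv (left_eq_add.1 h)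

/-- `v + v ≠ 0` for `v ≠ 0` (`ℤ^d` has no `2`-torsion). [cite: PavariniEtAl2001, eq. (1)] -/
theorem add_self_ne_zero_of_ne_zero {v : Site d} (hv : v ≠ 0) : v + v ≠ 0 := by
  intro h
  apply hv
  funext i
  have hi := congrFun h i
  simp only [Pi.add_apply, Pi.zero_apply] at hi ⊢
  omega

/-- `x + v + v ≠ x` for `v ≠ 0`. [cite: PavariniEtAl2001, eq. (1)] -/
theorem add_add_ne_self_of_ne_zero (x : Site d) {v : Site d} (hv : v ≠ 0) : x + v + v ≠ x := by
  intro h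
  rw [add_assoc, add_eq_left] at h
  exact add_self_ne_zero_of_ne_zero hv h

/-- The bond pair `{x, x + v}` has two elements. [cite: PavariniEtAl2001, eq. (1)] -/
theorem card_pair_add_of_ne_zero (x : Site d) {v : Site d} (hv : v ≠ 0) :
    ({x, x + v} : Finset (Site d)).card = 2 :=
  card_pair (self_ne_add_of_ne_zero x hv)

/-- Two bond pairs `{y, y + u} = {x, x + v}` with nonzero jumps have `u = ± v` (a bond determines its class
up to orientation). [cite: PavariniEtAl2001, eq. (1)] -/
theorem eq_or_eq_neg_of_pair_add_eq_pair_add {y u x v : Site d} (hu : u ≠ 0)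
    (h : ({y, y + u} : Finset (Site d)) = {x, x + v}) : u = v ∨ u = -v := by
  have hy : y ∈ ({x, x + v} : Finset (Site d)) := h ▸ mem_insert_self _ _
  have hyu : y + u ∈ ({x, x + v} : Finset (Site d)) := h ▸ mem_insert_of_mem (mem_singleton_self _)
  rw [mem_insert, mem_singleton] at hy hyu
  rcases hy with rfl | rfl
  · rcases hyu with h' | h'
    · exact absurd (add_eq_left.1 h') hu
    · exact Or.inl (add_left_cancel h')
  · rcases hyu with h' | h'
    · refine Or.inr ?_
      rw [add_assoc, add_eq_left] at h'
      exact eq_neg_of_add_eq_zero_right h'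
    · rw [add_assoc, add_right_inj, add_eq_left] at h'
      exact absurd h' hu

/-- The range box is symmetric: `v ∈ thicken {0} R ⇒ -v ∈ thicken {0} R`. [cite: FriedliVelenik2017, §3.2] -/
theorem neg_mem_thicken_zero {R : ℝ} {v : Site d} (hv : v ∈ thicken ({0} : Finset (Site d)) R) :
    -v ∈ thicken ({0} : Finset (Site d)) R := by
  rw [mem_thicken_zero_iff] at hv ⊢
  intro i
  have h := hv i
  rw [Pi.neg_apply]
  omega

/-- `{0, v} ⊆ thicken {0} R` when `v` lies in the range box. [cite: FriedliVelenik2017, §3.2] -/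
theorem pair_subset_thicken_zero {R : ℝ} {v : Site d} (hv : v ∈ thicken ({0} : Finset (Site d)) R) :
    ({0, 0 + v} : Finset (Site d)) ⊆ thicken ({0} : Finset (Site d)) R := by
  rw [zero_add]
  exact insert_subset (zero_mem_thicken_zero R) (singleton_subset_iff.2 hv)

/-- `{-v, 0} ⊆ thicken {0} R` when `v` lies in the range box. [cite: FriedliVelenik2017, §3.2] -/
theorem pair_neg_subset_thicken_zero {R : ℝ} {v : Site d} (hv : v ∈ thicken ({0} : Finset (Site d)) R) :
    ({-v, -v + v} : Finset (Site d)) ⊆ thicken ({0} : Finset (Site d)) R := by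
  rw [neg_add_cancel]
  exact insert_subset (neg_mem_thicken_zero hv) (singleton_subset_iff.2 (zero_mem_thicken_zero R))

/-! ### §2. The hopping interaction along a lattice vector -/

/-- **The hopping interaction along the lattice vector `v`** with amplitude `t`:
`Φ_v {x, x + v} = -t Σ_σ (c†_{xσ} c_{x+v,σ} + c†_{x+v,σ} c_{xσ})` and `Φ_v X = 0` for every other `X` —
an even Hermitian `FermionInteraction d` of range `‖v‖_∞`. Every one-band tight-binding term of a
downfolded Hamiltonian `−Σ_{x,R} t(R) Σ_σ (c†_{xσ} c_{x+R,σ} + h.c.)` (Pavarini et al. 2001 eq. (1):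
`t, t', t''`, and the longer-ranged `t(R)` of a Wannier fit) is a sum of such terms, one per bond class
`±R`; the nearest-neighbour, diagonal and axial range-2 interactions of the tree are the sums over
`v = e_i`, `v = e₁ ± e₂`, `v = 2e_i` (§4). For `v = 0` the formula degenerates (it reads `-2t Σ_σ n_{xσ}`
on singletons); all lemmas below assume `v ≠ 0`. [cite: PavariniEtAl2001, eq. (1)] -/
def vectorHoppingFermionInteraction (d : ℕ) (v : Site d) (t : ℝ) : FermionInteraction d where
  Φ X :=
    ∑ x ∈ X.attach, ∑ y ∈ X.attach,
      if y.1 = x.1 + v ∧ X = {x.1, y.1} then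
        -(t : ℂ) • ∑ σ : Fin 2, ((cAt x.1 x.2 σ)ᴴ * cAt y.1 y.2 σ + (cAt y.1 y.2 σ)ᴴ * cAt x.1 x.2 σ)
      else 0

/-- **The hopping interaction along `v` is even.** [cite: ArakiMoriya2003, §1 assumption (II)] -/
theorem vectorHoppingFermionInteraction_isEven (v : Site d) (t : ℝ) :
    (vectorHoppingFermionInteraction d v t).IsEven := by
  intro X
  have hc : ∀ (x y : Site d) (hx : x ∈ X) (hy : y ∈ X) (σ : Fin 2),
      parityAut ((cAt x hx σ)ᴴ * cAt y hy σ) = (cAt x hx σ)ᴴ * cAt y hy σ := by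
    intro x y hx hy σ
    rw [cAt, cAt, annihilation_conjTranspose, map_mul, parityAut_creation, parityAut_annihilation,
      neg_mul_neg]
  simp only [vectorHoppingFermionInteraction, map_sum, apply_ite parityAut, map_zero, map_smul,
    map_add, hc]

/-- **The hopping interaction along `v` is Hermitian** (real amplitude). [cite: PavariniEtAl2001, eq. (1)] -/
theorem vectorHoppingFermionInteraction_isHermitian (v : Site d) (t : ℝ) :
    (vectorHoppingFermionInteraction d v t).IsHermitian := by
  intro X
  have hc : ∀ (x y : Site d) (hx : x ∈ X) (hy : y ∈ X) (σ : Fin 2),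
      ((cAt x hx σ)ᴴ * cAt y hy σ + (cAt y hy σ)ᴴ * cAt x hx σ)ᴴ =
        (cAt x hx σ)ᴴ * cAt y hy σ + (cAt y hy σ)ᴴ * cAt x hx σ := by
    intro x y hx hy σ
    rw [Matrix.conjTranspose_add, Matrix.conjTranspose_mul, Matrix.conjTranspose_mul,
      Matrix.conjTranspose_conjTranspose, Matrix.conjTranspose_conjTranspose, add_comm]
  unfold Matrix.IsHermitian vectorHoppingFermionInteraction
  simp only [Matrix.conjTranspose_sum, apply_ite Matrix.conjTranspose, Matrix.conjTranspose_zero,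
    Matrix.conjTranspose_smul, hc, Complex.star_def, map_neg, Complex.conj_ofReal]

/-- **Scaling in the amplitude** (the pencil / linear-family hook): `Φ_v^{c·t} X = c • Φ_v^{t} X`, in
particular `Φ_v^{t} = t • Φ_v^{1}`. [cite: PavariniEtAl2001, eq. (1)] -/
theorem vectorHoppingFermionInteraction_smul_apply (v : Site d) (c t : ℝ) (X : Finset (Site d)) :
    (vectorHoppingFermionInteraction d v (c * t)).Φ X = (c : ℂ) • (vectorHoppingFermionInteraction d v t).Φ X := by
  simp only [vectorHoppingFermionInteraction, Finset.smul_sum, smul_ite, smul_zero, smul_smul,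
    Complex.ofReal_mul, mul_neg]

/-- At amplitude `0` every term vanishes. [cite: PavariniEtAl2001, eq. (1)] -/
theorem vectorHoppingFermionInteraction_zero_apply (v : Site d) (X : Finset (Site d)) :
    (vectorHoppingFermionInteraction d v 0).Φ X = 0 := by
  have h := vectorHoppingFermionInteraction_smul_apply v 0 1 X
  rwa [zero_mul, Complex.ofReal_zero, zero_smul] at h

/-- The terms are additive in the amplitude: `Φ_v^{t₁+t₂} X = Φ_v^{t₁} X + Φ_v^{t₂} X`.
[cite: PavariniEtAl2001, eq. (1)] -/
theorem vectorHoppingFermionInteraction_add_apply (v : Site d) (t₁ t₂ : ℝ) (X : Finset (Site d)) :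
    (vectorHoppingFermionInteraction d v (t₁ + t₂)).Φ X =
      (vectorHoppingFermionInteraction d v t₁).Φ X + (vectorHoppingFermionInteraction d v t₂).Φ X := by
  have h1 := vectorHoppingFermionInteraction_smul_apply v t₁ 1 X
  have h2 := vectorHoppingFermionInteraction_smul_apply v t₂ 1 X
  have h12 := vectorHoppingFermionInteraction_smul_apply v (t₁ + t₂) 1 X
  rw [mul_one] at h1 h2 h12
  rw [h1, h2, h12, Complex.ofReal_add, add_smul]

section Terms

variable {v : Site d} (hv : v ≠ 0) (t : ℝ)
include hv

/-- **Bond term**: `Φ_v {x, x + v} = -t Σ_σ (c†_{xσ} c_{x+v,σ} + c†_{x+v,σ} c_{xσ})`.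
[cite: PavariniEtAl2001, eq. (1)] -/
theorem vectorHoppingFermionInteraction_apply_pair (x : Site d) :
    (vectorHoppingFermionInteraction d v t).Φ {x, x + v} =
      -(t : ℂ) • ∑ σ : Fin 2,
        ((cAt x (mem_insert_self _ _) σ)ᴴ * cAt (x + v) (mem_insert_of_mem (mem_singleton_self _)) σ +
          (cAt (x + v) (mem_insert_of_mem (mem_singleton_self _)) σ)ᴴ * cAt x (mem_insert_self _ _) σ) := by
  have hmem : ∀ {a : Site d}, a ∈ ({x, x + v} : Finset (Site d)) ↔ a = x ∨ a = x + v :=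
    fun {a} => by rw [mem_insert, mem_singleton]
  simp only [vectorHoppingFermionInteraction]
  rw [Finset.sum_eq_single ⟨x, mem_insert_self _ _⟩]
  · rw [Finset.sum_eq_single ⟨x + v, mem_insert_of_mem (mem_singleton_self _)⟩, if_pos ⟨rfl, rfl⟩]
    · rintro ⟨b, hb⟩ - hne
      refine if_neg ?_
      rintro ⟨hb', -⟩
      exact hne (Subtype.ext hb')
    · intro h
      exact absurd (mem_attach _ _) h
  · rintro ⟨a, ha⟩ - hne
    refine Finset.sum_eq_zero fun b _ => if_neg ?_
    rintro ⟨hb, -⟩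
    rcases hmem.1 ha with rfl | rfl
    · exact hne rfl
    · rcases hmem.1 b.2 with hb' | hb'
      · exact add_add_ne_self_of_ne_zero x hv (hb.symm.trans hb')
      · exact self_ne_add_of_ne_zero (x + v) hv (hb'.symm.trans hb)
  · intro h
    exact absurd (mem_attach _ _) h

omit hv in
/-- **All other terms vanish**: if `X` is not a bond pair `{x, x + v}`, then `Φ_v X = 0`.
[cite: PavariniEtAl2001, eq. (1)] -/
theorem vectorHoppingFermionInteraction_apply_eq_zero {X : Finset (Site d)}
    (h2 : ∀ x : Site d, X ≠ {x, x + v}) : (vectorHoppingFermionInteraction d v t).Φ X = 0 := by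
  have hB : ∀ a b : Site d, ¬ (b = a + v ∧ X = {a, b}) := by
    rintro a b ⟨rfl, h⟩
    exact h2 a h
  simp only [vectorHoppingFermionInteraction, hB, if_false, sum_const_zero]

/-- A singleton is not a bond pair. [cite: PavariniEtAl2001, eq. (1)] -/
theorem singleton_ne_pair_add (y x : Site d) : ({y} : Finset (Site d)) ≠ {x, x + v} := by
  intro h
  have := congrArg Finset.card h
  rw [card_singleton, card_pair_add_of_ne_zero x hv] at this
  exact absurd this (by norm_num)

/-- The hopping interaction along `v` vanishes on singletons. [cite: PavariniEtAl2001, eq. (1)] -/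
theorem vectorHoppingFermionInteraction_apply_singleton (x : Site d) :
    (vectorHoppingFermionInteraction d v t).Φ {x} = 0 :=
  vectorHoppingFermionInteraction_apply_eq_zero t fun y => singleton_ne_pair_add hv x y

end Terms

/-- **`Φ_{-v} = Φ_v`**: the bond classes of `v` and `-v` coincide (`{x, x + v} = {(x+v), (x+v) + (-v)}` and
the bond operator is symmetric in its two ends) — one interaction per UNORIENTED bond class.
[cite: PavariniEtAl2001, eq. (1)] -/
theorem vectorHoppingFermionInteraction_neg (v : Site d) (t : ℝ) :
    vectorHoppingFermionInteraction d (-v) t = vectorHoppingFermionInteraction d v t := by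
  refine FermionInteraction.ext fun X => ?_
  simp only [vectorHoppingFermionInteraction]
  rw [Finset.sum_comm]
  refine Finset.sum_congr rfl fun x _ => Finset.sum_congr rfl fun y _ => ?_
  have hiff : (x.1 = y.1 + -v ∧ X = {y.1, x.1}) ↔ (y.1 = x.1 + v ∧ X = {x.1, y.1}) := by
    rw [pair_comm, ← sub_eq_add_neg, eq_sub_iff_add_eq]
    exact and_congr_left fun _ => ⟨fun h => h.symm, fun h => h.symm⟩
  by_cases h : y.1 = x.1 + v ∧ X = {x.1, y.1}
  · rw [if_pos h, if_pos (hiff.2 h)]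
    exact congrArg _ (Finset.sum_congr rfl fun σ _ => add_comm _ _)
  · rw [if_neg h, if_neg (mt hiff.1 h)]



/-! ### §3. The mean-energy observable `E_{Φ_v} = ½Φ_v{0,v} + ½Φ_v{-v,0}` and its norm -/

/-- Distinct sites of a region give distinct orbitals of the same spin. [folklore] -/
private theorem orb_pt_ne_of_ne {Λ : Finset (Site d)} {x y : Site d} (hx : x ∈ Λ) (hy : y ∈ Λ) (hxy : x ≠ y)
    (σ : Fin 2) : orb (PolySite.pt x hx) σ ≠ orb (PolySite.pt y hy) σ := by
  intro h
  have h1 := (orb_inj.1 h).1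
  have h2 := congrArg (fun p : PolySite Λ => ofLex p.1) h1
  simp only [PolySite.ofLex_coe_pt] at h2
  exact hxy h2

section MeanEnergy

variable {v : Site d} (hv : v ≠ 0) (t : ℝ)
include hv

/-- The two half bonds through the origin are different sets: `{0, v} ≠ {-v, 0}` (`v ≠ -v` in `ℤ^d`).
[cite: PavariniEtAl2001, eq. (1)] -/
theorem pair_zero_ne_pair_neg : ({0, 0 + v} : Finset (Site d)) ≠ {-v, -v + v} := by
  intro h
  have hmem : -v ∈ ({0, 0 + v} : Finset (Site d)) := h ▸ mem_insert_self _ _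
  rw [mem_insert, mem_singleton, zero_add, neg_eq_zero] at hmem
  rcases hmem with h' | h'
  · exact hv h'
  · refine add_self_ne_zero_of_ne_zero hv ?_
    nth_rewrite 1 [← h']
    exact neg_add_cancel v

/-- **The mean-energy observable of the hopping interaction along `v`** (any range parameter `R` whose
box contains `v`): in `𝔄_{[-R,R]^d}`, `E_{Φ_v} = ½ Γ(Φ_v{0, v}) + ½ Γ(Φ_v{-v, 0})`, one half of each of
the two `v`-bonds through the origin (every other `X ∋ 0` carries `Φ_v X = 0`).
[cite: BratteliKishimotoRobinson1978, §3 (mean energy functional)] -/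
theorem vectorHoppingFermionInteraction_meanEnergyObs {R : ℝ} (hvR : v ∈ thicken ({0} : Finset (Site d)) R) :
    (vectorHoppingFermionInteraction d v t).meanEnergyObs R =
      (2 : ℂ)⁻¹ • fermionEmbed (PolySite.incl (pair_subset_thicken_zero hvR))
          ((vectorHoppingFermionInteraction d v t).Φ {0, 0 + v}) +
        (2 : ℂ)⁻¹ • fermionEmbed (PolySite.incl (pair_neg_subset_thicken_zero hvR))
          ((vectorHoppingFermionInteraction d v t).Φ {-v, -v + v}) := by
  classical
  set T : Finset (Site d) := thicken ({0} : Finset (Site d)) R with hT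
  set F : Finset (Site d) → FermionOp T := fun X =>
    if h : X ⊆ T then ((X.card : ℂ)⁻¹) • fermionEmbed (PolySite.incl h) ((vectorHoppingFermionInteraction d v t).Φ X)
    else 0 with hF
  rw [FermionInteraction.meanEnergyObs_eq_sum]
  change ∑ X ∈ T.powerset with (0 : Site d) ∈ X, F X = _
  -- the support: `{0, v}`, `{-v, 0}`
  set S' : Finset (Finset (Site d)) := {({0, 0 + v} : Finset (Site d)), {-v, -v + v}} with hS'
  have hS'sub : S' ⊆ T.powerset.filter fun X => (0 : Site d) ∈ X := by
    intro X hX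
    rw [hS', mem_insert, mem_singleton] at hX
    rw [mem_filter, mem_powerset]
    rcases hX with rfl | rfl
    · exact ⟨pair_subset_thicken_zero hvR, mem_insert_self _ _⟩
    · refine ⟨pair_neg_subset_thicken_zero hvR, ?_⟩
      rw [neg_add_cancel]
      exact mem_insert_of_mem (mem_singleton_self _)
  have hzero : ∀ X ∈ T.powerset.filter (fun X => (0 : Site d) ∈ X), X ∉ S' → F X = 0 := by
    intro X hX hXS
    rw [mem_filter, mem_powerset] at hX
    have hΦ : (vectorHoppingFermionInteraction d v t).Φ X = 0 := by
      refine vectorHoppingFermionInteraction_apply_eq_zero t (fun x hx => hXS ?_)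
      have h0 := hX.2
      rw [hx, mem_insert, mem_singleton] at h0
      rw [hS', hx, mem_insert, mem_singleton]
      rcases h0 with h0 | h0
      · exact Or.inl (by rw [← h0, zero_add])
      · refine Or.inr ?_
        have : x = -v := eq_neg_of_add_eq_zero_left h0.symm
        rw [this]
    simp only [hF, hΦ, map_zero, smul_zero, dite_eq_ite, ite_self]
  rw [← Finset.sum_subset hS'sub hzero, hS', Finset.sum_pair (pair_zero_ne_pair_neg hv)]
  have h1T : ({0, 0 + v} : Finset (Site d)) ⊆ T := pair_subset_thicken_zero hvR
  have h2T : ({-v, -v + v} : Finset (Site d)) ⊆ T := pair_neg_subset_thicken_zero hvR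
  have hF1 : F {0, 0 + v} =
      (2 : ℂ)⁻¹ • fermionEmbed (PolySite.incl h1T) ((vectorHoppingFermionInteraction d v t).Φ {0, 0 + v}) := by
    simp only [hF]
    rw [dif_pos h1T, card_pair_add_of_ne_zero (0 : Site d) hv, Nat.cast_ofNat]
  have hF2 : F {-v, -v + v} =
      (2 : ℂ)⁻¹ • fermionEmbed (PolySite.incl h2T) ((vectorHoppingFermionInteraction d v t).Φ {-v, -v + v}) := by
    simp only [hF]
    rw [dif_pos h2T, card_pair_add_of_ne_zero (-v : Site d) hv, Nat.cast_ofNat]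
  rw [hF1, hF2]

open scoped Matrix.Norms.L2Operator in
/-- **An embedded bond term has norm `≤ 2|t|`** (Koma–Tasaki: `‖Σ_σ(c†_{xσ}c_{yσ} + h.c.)‖ ≤ 2` for
`x ≠ y`, the tree's `norm_hoppingTerm_le_two_mul`). [cite: KomaTasakiPRL1992, eq. (11) remark] -/
theorem norm_fermionEmbed_vectorHopping_pair_le_two_mul {Λ' : Finset (Site d)} (x : Site d)
    (h : ({x, x + v} : Finset (Site d)) ⊆ Λ') :
    ‖fermionEmbed (PolySite.incl h) ((vectorHoppingFermionInteraction d v t).Φ {x, x + v})‖ ≤ 2 * |t| := by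
  rw [vectorHoppingFermionInteraction_apply_pair hv, fermionEmbed_smul, fermionEmbed_sum]
  simp only [fermionEmbed_add, fermionEmbed_mul, fermionEmbed_conjTranspose, fermionEmbed_incl_cAt]
  exact norm_hoppingTerm_le_two_mul t (fun σ => orb (PolySite.pt x (h (mem_insert_self _ _))) σ)
    (fun σ => orb (PolySite.pt (x + v) (h (mem_insert_of_mem (mem_singleton_self _)))) σ)
    fun σ => orb_pt_ne_of_ne _ _ (self_ne_add_of_ne_zero x hv) σ

open scoped Matrix.Norms.L2Operator in
/-- **`‖E_{Φ_v}‖ ≤ 2|t|`** (two half bonds of norm `≤ 2|t|` each): the operator-norm Lipschitz constant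
of every ground-state energy density in the amplitude of ONE bond class is `2` per unit amplitude
(`TIGroundEnergyDensityCouplingFamilies.abs_infMeanEnergyOn_linearFamily_sub_le_norm`).
[cite: BratteliRobinsonI1987, Prop. 2.3.11] -/
theorem norm_meanEnergyObs_vectorHopping_le {R : ℝ} (hvR : v ∈ thicken ({0} : Finset (Site d)) R) :
    ‖(vectorHoppingFermionInteraction d v t).meanEnergyObs R‖ ≤ 2 * |t| := by
  rw [vectorHoppingFermionInteraction_meanEnergyObs hv t hvR]
  have hhalf : ‖(2 : ℂ)⁻¹‖ = 2⁻¹ := by simp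
  refine (norm_add_le _ _).trans ?_
  rw [norm_smul, norm_smul, hhalf]
  have h1 := norm_fermionEmbed_vectorHopping_pair_le_two_mul hv t (0 : Site d) (pair_subset_thicken_zero hvR)
  have h2 := norm_fermionEmbed_vectorHopping_pair_le_two_mul hv t (-v : Site d) (pair_neg_subset_thicken_zero hvR)
  linarith

/-- **`|K_v(ω)| ≤ 2|t|` for EVERY state**: the `v`-bond energy per site `e_{Φ_v}(ω)` of any
infinite-volume state is bounded by the norm (states are contractive). [cite: BratteliRobinsonI1987, Prop. 2.3.11] -/
theorem abs_meanEnergy_vectorHopping_le (ω : InfVolFermionState d) {R : ℝ}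
    (hvR : v ∈ thicken ({0} : Finset (Site d)) R) :
    |ω.meanEnergy (vectorHoppingFermionInteraction d v t) R| ≤ 2 * |t| :=
  (ω.abs_meanEnergy_le_norm _ R).trans (norm_meanEnergyObs_vectorHopping_le hv t hvR)

end MeanEnergy

/-! ### §4. Dictionary: the `t`, `t'`, `t''` interactions are sums of single-vector hops -/

section Dictionary

/-- Summing a bond indicator over an injective family of jumps: at most one jump `u_i` fits `y = x + u_i`.
[folklore] -/
private theorem sum_ite_eq_add_and {κ M : Type*} [Fintype κ] [AddCommMonoid M] {u : κ → Site d}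
    (hu : Function.Injective u) (x y : Site d) (P : Prop) (b : M) {_hd : ∀ i, Decidable (y = x + u i ∧ P)}
    {_hd' : Decidable ((∃ i, y = x + u i) ∧ P)} :
    (∑ i, if y = x + u i ∧ P then b else 0) = if (∃ i, y = x + u i) ∧ P then b else 0 := by
  by_cases h : ∃ i, y = x + u i
  · obtain ⟨i, hi⟩ := h
    rw [Finset.sum_eq_single i]
    · by_cases hP : P
      · rw [if_pos ⟨hi, hP⟩, if_pos ⟨⟨i, hi⟩, hP⟩]
      · rw [if_neg fun h => hP h.2, if_neg fun h => hP h.2]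
    · intro j _ hji
      refine if_neg fun hj => hji (hu ?_)
      exact add_left_cancel (hj.1.symm.trans hi)
    · intro hi'
      exact absurd (Finset.mem_univ i) hi'
  · have h' : ∀ i, ¬ (y = x + u i ∧ P) := fun i hi => h ⟨i, hi.1⟩
    simp only [h', if_false, Finset.sum_const_zero]
    rw [if_neg fun hh => h hh.1]

/-- **The nearest-neighbour Hubbard interaction = on-site part + the `d` unit-vector hops**:
`Φ^{t,U} X = Φ^{0,U} X + Σ_i Φ_{e_i}^{t} X`. [cite: arXiv9311033, §2 (the Hubbard Hamiltonian)] -/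
theorem hubbardFermionInteraction_apply_eq_onSite_add_sum_vectorHopping (t U : ℝ) (X : Finset (Site d)) :
    (hubbardFermionInteraction d t U).Φ X =
      (hubbardFermionInteraction d 0 U).Φ X + ∑ i : Fin d, (vectorHoppingFermionInteraction d (unitVec i) t).Φ X := by
  simp only [hubbardFermionInteraction, vectorHoppingFermionInteraction, Complex.ofReal_zero, neg_zero, zero_smul,
    ite_self, Finset.sum_const_zero, add_zero]
  congr 1
  symm
  rw [Finset.sum_comm (s := (Finset.univ : Finset (Fin d))) (t := X.attach)]
  refine Finset.sum_congr rfl fun x _ => ?_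
  rw [Finset.sum_comm (s := (Finset.univ : Finset (Fin d))) (t := X.attach)]
  refine Finset.sum_congr rfl fun y _ => ?_
  exact sum_ite_eq_add_and (M := FermionOp X) uvec_injective _ _ _ _

/-- **The diagonal hopping interaction = the two diagonal hops**: `Φ'^{t'} X = Σ_s Φ_{e₁ ± e₂}^{t'} X`.
[cite: XuEtAl2024, eq. (1)] -/
theorem diagHoppingFermionInteraction_apply_eq_sum_vectorHopping (t' : ℝ) (X : Finset (Site 2)) :
    (diagHoppingFermionInteraction t').Φ X = ∑ s : Fin 2, (vectorHoppingFermionInteraction 2 (diagVec s) t').Φ X := by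
  simp only [diagHoppingFermionInteraction, vectorHoppingFermionInteraction]
  symm
  rw [Finset.sum_comm (s := (Finset.univ : Finset (Fin 2))) (t := X.attach)]
  refine Finset.sum_congr rfl fun x _ => ?_
  rw [Finset.sum_comm (s := (Finset.univ : Finset (Fin 2))) (t := X.attach)]
  refine Finset.sum_congr rfl fun y _ => ?_
  exact sum_ite_eq_add_and (M := FermionOp X) diagVec_injective _ _ _ _

/-- **The axial range-2 hopping interaction = the `d` doubled unit-vector hops**: `Φ''^{t''} X = Σ_i Φ_{2e_i}^{t''} X`.
[cite: PavariniEtAl2001, eq. (1)] -/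
theorem axialRange2HoppingFermionInteraction_apply_eq_sum_vectorHopping (t'' : ℝ) (X : Finset (Site d)) :
    (axialRange2HoppingFermionInteraction d t'').Φ X =
      ∑ i : Fin d, (vectorHoppingFermionInteraction d (axial2Vec i) t'').Φ X := by
  simp only [axialRange2HoppingFermionInteraction, vectorHoppingFermionInteraction]
  symm
  rw [Finset.sum_comm (s := (Finset.univ : Finset (Fin d))) (t := X.attach)]
  refine Finset.sum_congr rfl fun x _ => ?_
  rw [Finset.sum_comm (s := (Finset.univ : Finset (Fin d))) (t := X.attach)]
  refine Finset.sum_congr rfl fun y _ => ?_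
  exact sum_ite_eq_add_and (M := FermionOp X) axial2Vec_injective _ _ _ _

/-- **Linear-family form of the nearest-neighbour Hubbard interaction**: `Φ^{t,U}` is the family with base
`Φ^{0,U}` (on-site repulsion), directions the unit hops `Φ_{e_i}^{1}` and all `d` couplings equal to `t`.
[cite: KomaTasaki1994, §1] -/
theorem hubbardFermionInteraction_eq_linearFamily_vectorHopping (t U : ℝ) :
    hubbardFermionInteraction d t U =
      FermionInteraction.linearFamily (hubbardFermionInteraction d 0 U)
        (fun i : Fin d => vectorHoppingFermionInteraction d (unitVec i) 1) (fun _ => t) := by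
  refine FermionInteraction.ext fun X => ?_
  rw [FermionInteraction.linearFamily_apply, hubbardFermionInteraction_apply_eq_onSite_add_sum_vectorHopping]
  refine congrArg _ (Finset.sum_congr rfl fun i _ => ?_)
  have h := vectorHoppingFermionInteraction_smul_apply (unitVec i : Site d) t 1 X
  rwa [mul_one] at h

/-- **Mean energy: `e_{Φ^{t,U}}(ω) = e_{Φ^{0,U}}(ω) + t Σ_i K_{e_i}(ω)`** (`K_v(ω) = e_{Φ_v^1}(ω)` the
`v`-bond energy per site), for every state and range parameter. [cite: BratteliKishimotoRobinson1978, §3] -/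
theorem InfVolFermionState.meanEnergy_hubbardFermionInteraction_eq_add_sum (ω : InfVolFermionState d)
    (t U R : ℝ) :
    ω.meanEnergy (hubbardFermionInteraction d t U) R =
      ω.meanEnergy (hubbardFermionInteraction d 0 U) R +
        ∑ i : Fin d, t * ω.meanEnergy (vectorHoppingFermionInteraction d (unitVec i) 1) R := by
  rw [hubbardFermionInteraction_eq_linearFamily_vectorHopping (d := d) t U, ω.meanEnergy_linearFamily]

/-- The pure on-site interaction `Φ^{0,0}` is zero. [cite: arXiv9311033, §2] -/
theorem hubbardFermionInteraction_zero_zero_apply (X : Finset (Site d)) :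
    (hubbardFermionInteraction d 0 0).Φ X = 0 := by
  have h := hubbardFermionInteraction_smul 0 0 0 X
  rwa [mul_zero, Complex.ofReal_zero, zero_smul] at h

/-- **`K₁(ω) = Σ_i K_{e_i}(ω)`**: the unit nearest-neighbour hopping energy per site is the sum of the
`d` unit-vector bond energies. [cite: BratteliKishimotoRobinson1978, §3] -/
theorem InfVolFermionState.meanEnergy_nnHop_eq_sum_vectorHopping (ω : InfVolFermionState d) (R : ℝ) :
    ω.meanEnergy (hubbardFermionInteraction d 1 0) R =
      ∑ i : Fin d, ω.meanEnergy (vectorHoppingFermionInteraction d (unitVec i) 1) R := by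
  rw [ω.meanEnergy_hubbardFermionInteraction_eq_add_sum 1 0 R]
  have h0 : ω.meanEnergy (hubbardFermionInteraction d 0 0) R = 0 := by
    rw [InfVolFermionState.meanEnergy,
      FermionInteraction.meanEnergyObs_of_smul (c := 0) (Ψ₁ := hubbardFermionInteraction d 0 0)
        (fun X => by rw [hubbardFermionInteraction_zero_zero_apply, smul_zero]),
      zero_smul, map_zero, Complex.zero_re]
  rw [h0, zero_add]
  exact Finset.sum_congr rfl fun i _ => one_mul _

/-- **`K₂(ω) = Σ_s K_{e₁±e₂}(ω)`** (unit diagonal hopping energy per site of `ℤ²` = the two diagonal bond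
energies). [cite: XuEtAl2024, eq. (1)] -/
theorem InfVolFermionState.meanEnergy_diagHop_eq_sum_vectorHopping (ω : InfVolFermionState 2) (R : ℝ) :
    ω.meanEnergy (diagHoppingFermionInteraction 1) R =
      ∑ s : Fin 2, ω.meanEnergy (vectorHoppingFermionInteraction 2 (diagVec s) 1) R := by
  have h : diagHoppingFermionInteraction 1 =
      FermionInteraction.linearFamily (diagHoppingFermionInteraction 0)
        (fun s : Fin 2 => vectorHoppingFermionInteraction 2 (diagVec s) 1) (fun _ => 1) := by
    refine FermionInteraction.ext fun X => ?_
    rw [FermionInteraction.linearFamily_apply, diagHoppingFermionInteraction_apply_eq_sum_vectorHopping,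
      diagHoppingFermionInteraction_apply_eq_sum_vectorHopping]
    simp only [vectorHoppingFermionInteraction_zero_apply, Finset.sum_const_zero, zero_add, Complex.ofReal_one,
      one_smul]
  have h0 : ω.meanEnergy (diagHoppingFermionInteraction 0) R = 0 := by
    rw [InfVolFermionState.meanEnergy,
      FermionInteraction.meanEnergyObs_of_smul (c := 0) (Ψ₁ := diagHoppingFermionInteraction 1)
        (fun X => by
          have h' := diagHoppingFermionInteraction_smul 0 1 X
          rwa [zero_mul, Complex.ofReal_zero] at h'),
      zero_smul, map_zero, Complex.zero_re]
  rw [h, ω.meanEnergy_linearFamily, h0, zero_add]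
  exact Finset.sum_congr rfl fun s _ => one_mul _

/-- **`K₃(ω) = Σ_i K_{2e_i}(ω)`** (unit axial range-2 hopping energy per site = the `d` doubled-unit-vector
bond energies). [cite: PavariniEtAl2001, eq. (1)] -/
theorem InfVolFermionState.meanEnergy_axialRange2Hopping_eq_sum_vectorHopping (ω : InfVolFermionState d) (R : ℝ) :
    ω.meanEnergy (axialRange2HoppingFermionInteraction d 1) R =
      ∑ i : Fin d, ω.meanEnergy (vectorHoppingFermionInteraction d (axial2Vec i) 1) R := by
  have h : axialRange2HoppingFermionInteraction d 1 =
      FermionInteraction.linearFamily (axialRange2HoppingFermionInteraction d 0)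
        (fun i : Fin d => vectorHoppingFermionInteraction d (axial2Vec i) 1) (fun _ => 1) := by
    refine FermionInteraction.ext fun X => ?_
    rw [FermionInteraction.linearFamily_apply, axialRange2HoppingFermionInteraction_apply_eq_sum_vectorHopping,
      axialRange2HoppingFermionInteraction_apply_eq_sum_vectorHopping]
    simp only [vectorHoppingFermionInteraction_zero_apply, Finset.sum_const_zero, zero_add, Complex.ofReal_one,
      one_smul]
  have h0 : ω.meanEnergy (axialRange2HoppingFermionInteraction d 0) R = 0 := by
    rw [InfVolFermionState.meanEnergy,
      FermionInteraction.meanEnergyObs_of_smul (c := 0) (Ψ₁ := axialRange2HoppingFermionInteraction d 1)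
        (fun X => by
          have h' := axialRange2HoppingFermionInteraction_smul_apply 0 1 X
          rwa [zero_mul, Complex.ofReal_zero] at h'),
      zero_smul, map_zero, Complex.zero_re]
  rw [h, ω.meanEnergy_linearFamily, h0, zero_add]
  exact Finset.sum_congr rfl fun i _ => one_mul _

end Dictionary

/-! ### §5. Pullback along injective additive lattice maps: `K_v(ω ∘ Γ_f) = K_{f(v)}(ω)` -/

section Pullback

/-- **A `v`-bond term is carried onto a `w`-bond term** (same amplitude) by every pair of ordered-site
embeddings into a common region sending `x, x + v` and `y, y + w` to the same two sites: both are
`−t Σ_σ (c†c + h.c.)` on those sites. The general form of the doubling / checkerboard bond identities of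
`InfVolFermionStateLatticeMapPullback` / `HubbardTTPrimeCheckerboardSublatticeFloor`. [cite: ArakiMoriya2003, §4.1] -/
theorem fermionEmbed_vectorHopping_pair_eq (t : ℝ) {v : Site d} (hv : v ≠ 0) {w : Site d'} (hw : w ≠ 0)
    {d'' : ℕ} {Λ' : Finset (Site d'')} (x : Site d) (y : Site d')
    (φ : PolySite ({x, x + v} : Finset (Site d)) ↪ PolySite Λ')
    (ψ : PolySite ({y, y + w} : Finset (Site d')) ↪ PolySite Λ')
    (hx : ofLex (φ (PolySite.pt x (mem_insert_self _ _))).1 = ofLex (ψ (PolySite.pt y (mem_insert_self _ _))).1)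
    (hxv : ofLex (φ (PolySite.pt (x + v) (mem_insert_of_mem (mem_singleton_self _)))).1 =
      ofLex (ψ (PolySite.pt (y + w) (mem_insert_of_mem (mem_singleton_self _)))).1) :
    fermionEmbed φ ((vectorHoppingFermionInteraction d v t).Φ {x, x + v}) =
      fermionEmbed ψ ((vectorHoppingFermionInteraction d' w t).Φ {y, y + w}) := by
  replace hx : φ (PolySite.pt x (mem_insert_self _ _)) = ψ (PolySite.pt y (mem_insert_self _ _)) :=
    Subtype.ext (by rw [← toLex_ofLex (φ _).1, hx, toLex_ofLex])
  replace hxv : φ (PolySite.pt (x + v) (mem_insert_of_mem (mem_singleton_self _))) =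
      ψ (PolySite.pt (y + w) (mem_insert_of_mem (mem_singleton_self _))) :=
    Subtype.ext (by rw [← toLex_ofLex (φ _).1, hxv, toLex_ofLex])
  rw [vectorHoppingFermionInteraction_apply_pair hv, vectorHoppingFermionInteraction_apply_pair hw, map_smul,
    map_smul, map_sum, map_sum]
  refine congrArg _ (Finset.sum_congr rfl fun σ _ => ?_)
  rw [map_add, map_add, map_mul, map_mul, map_mul, map_mul, fermionEmbed_conjTranspose,
    fermionEmbed_conjTranspose, fermionEmbed_conjTranspose, fermionEmbed_conjTranspose,
    fermionEmbed_cAt_of_apply_eq φ _ (PolySite.ofLex_mem _) (by rw [hx, PolySite.pt_ofLex]) σ,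
    fermionEmbed_cAt_of_apply_eq φ _ (PolySite.ofLex_mem _) (by rw [hxv, PolySite.pt_ofLex]) σ,
    fermionEmbed_cAt_of_apply_eq ψ _ (PolySite.ofLex_mem _) (PolySite.pt_ofLex _).symm σ,
    fermionEmbed_cAt_of_apply_eq ψ _ (PolySite.ofLex_mem _) (PolySite.pt_ofLex _).symm σ]

/-- An injective additive map kills no nonzero vector. [folklore] -/
private theorem AddMonoidHom.apply_ne_zero_of_injective (f : Site d →+ Site d') (hf : Function.Injective f)
    {v : Site d} (hv : v ≠ 0) : f v ≠ 0 := fun h => hv (hf (by rw [h, map_zero]))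

/-- **PULLBACK OF A BOND ENERGY: `K_v^{t}(ω ∘ Γ_f) = K_{f(v)}^{t}(ω)`.** For an injective additive lattice
map `f : ℤ^d → ℤ^{d'}`, the `v`-bond energy per site of the pulled-back state `ω ∘ Γ_f` is the
`f(v)`-bond energy per site of `ω` (any range parameters whose boxes contain `v`, resp. `f(v)`).
[cite: BratteliRobinsonI1987, §4.3.1] -/
theorem InfVolFermionState.meanEnergy_vectorHopping_mapAct (ω : InfVolFermionState d') (f : Site d →+ Site d')
    (hf : Function.Injective f) {v : Site d} (hv : v ≠ 0) (t : ℝ) {R R' : ℝ}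
    (hvR : v ∈ thicken ({0} : Finset (Site d)) R) (hfv : f v ∈ thicken ({0} : Finset (Site d')) R') :
    (ω.mapAct f hf).meanEnergy (vectorHoppingFermionInteraction d v t) R =
      ω.meanEnergy (vectorHoppingFermionInteraction d' (f v) t) R' := by
  have hfv0 : f v ≠ 0 := AddMonoidHom.apply_ne_zero_of_injective f hf hv
  rw [InfVolFermionState.meanEnergy, InfVolFermionState.meanEnergy, InfVolFermionState.mapAct_expect]
  have h1 : mapSet f (thicken ({0} : Finset (Site d)) R) ⊆
      mapSet f (thicken ({0} : Finset (Site d)) R) ∪ thicken ({0} : Finset (Site d')) R' := subset_union_left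
  have h2 : thicken ({0} : Finset (Site d')) R' ⊆
      mapSet f (thicken ({0} : Finset (Site d)) R) ∪ thicken ({0} : Finset (Site d')) R' := subset_union_right
  congr 1
  refine ω.expect_fermionEmbed_incl_eq h1 h2 _ _ ?_
  rw [vectorHoppingFermionInteraction_meanEnergyObs hv t hvR, vectorHoppingFermionInteraction_meanEnergyObs hfv0 t hfv,
    map_add, map_add, map_add, map_smul, map_smul, map_smul, map_smul, map_smul, map_smul,
    fermionEmbed_fermionEmbed, fermionEmbed_fermionEmbed, fermionEmbed_fermionEmbed, fermionEmbed_fermionEmbed,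
    fermionEmbed_fermionEmbed, fermionEmbed_fermionEmbed]
  refine congrArg₂ (· + ·) (congrArg _ ?_) (congrArg _ ?_)
  · refine fermionEmbed_vectorHopping_pair_eq t hv hfv0 0 0 _ _ ?_ ?_
    · simp only [Function.Embedding.trans_apply, PolySite.incl_pt, PolySite.mapEmb_pt, PolySite.ofLex_coe_pt, map_zero]
    · simp only [Function.Embedding.trans_apply, PolySite.incl_pt, PolySite.mapEmb_pt, PolySite.ofLex_coe_pt,
        zero_add]
  · refine fermionEmbed_vectorHopping_pair_eq t hv hfv0 (-v) (-f v) _ _ ?_ ?_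
    · simp only [Function.Embedding.trans_apply, PolySite.incl_pt, PolySite.mapEmb_pt, PolySite.ofLex_coe_pt, map_neg]
    · simp only [Function.Embedding.trans_apply, PolySite.incl_pt, PolySite.mapEmb_pt, PolySite.ofLex_coe_pt,
        neg_add_cancel, map_zero]

end Pullback

/-! ### §6. The kinematic PAIR rows `|K_v(ω) + K_w(ω)| ≤ 16/π²` -/

section PairRows

/-- **The additive map `ℤ² → ℤ^{d'}` with `e₀ ↦ v`, `e₁ ↦ w`**, `x ↦ x₀ v + x₁ w`: it carries the
nearest-neighbour bonds of `ℤ²` onto the `v`- and `w`-bonds of `ℤ^{d'}`; injective iff `v, w` are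
`ℤ`-linearly independent (for `d' = 2`: `det(v, w) ≠ 0`, `pairMap_injective_of_det_ne_zero`).
[cite: ArakiMoriya2003, §4.1] -/
def latticePairMap (v w : Site d') : Site 2 →+ Site d' where
  toFun x := x 0 • v + x 1 • w
  map_zero' := by simp
  map_add' x y := by
    simp only [Pi.add_apply, add_smul]
    abel

/-- `latticePairMap v w x = x₀ v + x₁ w`. [cite: ArakiMoriya2003, §4.1] -/
@[simp] theorem pairMap_apply (v w : Site d') (x : Site 2) : latticePairMap v w x = x 0 • v + x 1 • w := rfl

/-- `latticePairMap v w e₀ = v`. [cite: ArakiMoriya2003, §4.1] -/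
@[simp] theorem pairMap_unitVec_zero (v w : Site d') : latticePairMap v w (unitVec 0) = v := by
  simp [pairMap_apply, unitVec]

/-- `latticePairMap v w e₁ = w`. [cite: ArakiMoriya2003, §4.1] -/
@[simp] theorem pairMap_unitVec_one (v w : Site d') : latticePairMap v w (unitVec 1) = w := by
  simp [pairMap_apply, unitVec]

/-- **Injectivity criterion on `ℤ²`**: `det(v, w) = v₀w₁ − v₁w₀ ≠ 0` ⇒ `latticePairMap v w` is injective
(Cramer; the sublattice `ℤv + ℤw` is a rank-2 copy of `ℤ²`). [cite: ArakiMoriya2003, §4.1] -/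
theorem pairMap_injective_of_det_ne_zero {v w : Site 2} (h : v 0 * w 1 - v 1 * w 0 ≠ 0) :
    Function.Injective (latticePairMap v w) := by
  intro x y hxy
  have h0 := congrFun hxy 0
  have h1 := congrFun hxy 1
  simp only [pairMap_apply, Pi.add_apply, Pi.smul_apply, smul_eq_mul] at h0 h1
  have e0 : (x 0 - y 0) * (v 0 * w 1 - v 1 * w 0) = 0 := by linear_combination w 1 * h0 - w 0 * h1
  have e1 : (x 1 - y 1) * (v 0 * w 1 - v 1 * w 0) = 0 := by linear_combination v 0 * h1 - v 1 * h0
  rcases mul_eq_zero.1 e0 with e0 | e0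
  · rcases mul_eq_zero.1 e1 with e1 | e1
    · funext i
      fin_cases i
      · exact sub_eq_zero.1 e0
      · exact sub_eq_zero.1 e1
    · exact absurd e1 h
  · exact absurd e0 h

/-- **`K₁(ω ∘ Γ_f) = K_v(ω) + K_w(ω)`** for `f = latticePairMap v w` injective: the unit nearest-neighbour hopping
energy per site of the pulled-back state on `ℤ²` is the sum of the unit `v`- and `w`-bond energies of `ω`.
[cite: BratteliRobinsonI1987, §4.3.1] -/
theorem InfVolFermionState.meanEnergy_nnHop_mapAct_pairMap (ω : InfVolFermionState d') {v w : Site d'}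
    (hf : Function.Injective (latticePairMap v w)) {R : ℝ} (hvR : v ∈ thicken ({0} : Finset (Site d')) R)
    (hwR : w ∈ thicken ({0} : Finset (Site d')) R) :
    (ω.mapAct (latticePairMap v w) hf).meanEnergy (hubbardFermionInteraction 2 1 0) 1 =
      ω.meanEnergy (vectorHoppingFermionInteraction d' v 1) R +
        ω.meanEnergy (vectorHoppingFermionInteraction d' w 1) R := by
  have hv' : latticePairMap v w (unitVec 0) ∈ thicken ({0} : Finset (Site d')) R := by rwa [pairMap_unitVec_zero]
  have hw' : latticePairMap v w (unitVec 1) ∈ thicken ({0} : Finset (Site d')) R := by rwa [pairMap_unitVec_one]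
  rw [InfVolFermionState.meanEnergy_nnHop_eq_sum_vectorHopping, Fin.sum_univ_two,
    InfVolFermionState.meanEnergy_vectorHopping_mapAct ω _ hf (uvec_ne_zero 0) 1 (unitVec_mem_thicken_one 0) hv',
    InfVolFermionState.meanEnergy_vectorHopping_mapAct ω _ hf (uvec_ne_zero 1) 1 (unitVec_mem_thicken_one 1) hw',
    pairMap_unitVec_zero, pairMap_unitVec_one]

/-- **THE KINEMATIC PAIR ROW.** For every translation-invariant state `ω` on `ℤ^{d'}` (any filling) and
every `ℤ`-independent pair of lattice vectors `v, w` (`latticePairMap v w` injective):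
`|K_v(ω) + K_w(ω)| ≤ 16/π²` — the pulled-back state `ω ∘ Γ_{latticePairMap v w}` is a translation-invariant state
on `ℤ²` whose unit nearest-neighbour hopping energy is `K_v(ω) + K_w(ω)`, and the class-wide `K₁` row
(`IsTranslationInvariant.abs_meanEnergy_nnHop_le_of_any_density`: the half-filled free band) applies.
[cite: LiebLoss1993, §8, Theorem 8.2] -/
theorem InfVolFermionState.IsTranslationInvariant.abs_meanEnergy_vectorHopping_add_le
    {ω : InfVolFermionState d'} (hω : ω.IsTranslationInvariant) {v w : Site d'}
    (hf : Function.Injective (latticePairMap v w)) {R : ℝ} (hvR : v ∈ thicken ({0} : Finset (Site d')) R)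
    (hwR : w ∈ thicken ({0} : Finset (Site d')) R) :
    |ω.meanEnergy (vectorHoppingFermionInteraction d' v 1) R +
        ω.meanEnergy (vectorHoppingFermionInteraction d' w 1) R| ≤ 16 / Real.pi ^ 2 := by
  have hrow := (hω.mapAct (latticePairMap v w) hf).abs_meanEnergy_nnHop_le_of_any_density
  rwa [hubbardTTPrimeFermionInteraction_tPrime_zero, ω.meanEnergy_nnHop_mapAct_pairMap hf hvR hwR] at hrow

/-- Two-sided form of the pair row. [cite: LiebLoss1993, §8, Theorem 8.2] -/
theorem InfVolFermionState.IsTranslationInvariant.meanEnergy_vectorHopping_add_mem_Icc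
    {ω : InfVolFermionState d'} (hω : ω.IsTranslationInvariant) {v w : Site d'}
    (hf : Function.Injective (latticePairMap v w)) {R : ℝ} (hvR : v ∈ thicken ({0} : Finset (Site d')) R)
    (hwR : w ∈ thicken ({0} : Finset (Site d')) R) :
    ω.meanEnergy (vectorHoppingFermionInteraction d' v 1) R + ω.meanEnergy (vectorHoppingFermionInteraction d' w 1) R ∈
      Set.Icc (-(16 / Real.pi ^ 2)) (16 / Real.pi ^ 2) :=
  abs_le.1 (hω.abs_meanEnergy_vectorHopping_add_le hf hvR hwR)

end PairRows

/-! ### §7. Instances on `ℤ²`: the diagonal, axial and KNIGHT-MOVE (`t‴`) pair rows -/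

section Knight

/-- The knight-move (fourth-neighbour, `t‴`) jumps of `ℤ²`, one per unoriented bond class:
`(2,1), (1,2), (2,−1), (1,−2)`. [cite: PavariniEtAl2001, eq. (1)] -/
def knightVec : Fin 4 → Site 2 := ![![2, 1], ![1, 2], ![2, -1], ![1, -2]]

/-- Every knight jump lies in the range box `[-2,2]²`. [cite: FriedliVelenik2017, §3.2] -/
theorem knightVec_mem_thicken_two (k : Fin 4) : knightVec k ∈ thicken ({0} : Finset (Site 2)) 2 := by
  rw [mem_thicken_zero_iff, Nat.floor_ofNat]
  intro i
  fin_cases k <;> fin_cases i <;> simp [knightVec]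

/-- `det((2,1),(1,2)) = 3 ≠ 0`: the first knight pair spans a rank-2 sublattice. [cite: PavariniEtAl2001, eq. (1)] -/
theorem pairMap_knight01_injective : Function.Injective (latticePairMap (knightVec 0) (knightVec 1)) :=
  pairMap_injective_of_det_ne_zero (by simp [knightVec])

/-- `det((2,−1),(1,−2)) = −3 ≠ 0`: the second knight pair spans a rank-2 sublattice. [cite: PavariniEtAl2001, eq. (1)] -/
theorem pairMap_knight23_injective : Function.Injective (latticePairMap (knightVec 2) (knightVec 3)) :=
  pairMap_injective_of_det_ne_zero (by simp [knightVec])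

/-- **KNIGHT-MOVE PAIR ROWS** (new kinematic rows for the `t‴` direction of downfolded cuprate bands): for
every translation-invariant state on `ℤ²`, `|K_{(2,1)}(ω) + K_{(1,2)}(ω)| ≤ 16/π²` and
`|K_{(2,−1)}(ω) + K_{(1,−2)}(ω)| ≤ 16/π²`. [cite: LiebLoss1993, §8, Theorem 8.2] -/
theorem InfVolFermionState.IsTranslationInvariant.abs_meanEnergy_knight_pairs_le {ω : InfVolFermionState 2}
    (hω : ω.IsTranslationInvariant) :
    |ω.meanEnergy (vectorHoppingFermionInteraction 2 (knightVec 0) 1) 2 +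
        ω.meanEnergy (vectorHoppingFermionInteraction 2 (knightVec 1) 1) 2| ≤ 16 / Real.pi ^ 2 ∧
      |ω.meanEnergy (vectorHoppingFermionInteraction 2 (knightVec 2) 1) 2 +
        ω.meanEnergy (vectorHoppingFermionInteraction 2 (knightVec 3) 1) 2| ≤ 16 / Real.pi ^ 2 :=
  ⟨hω.abs_meanEnergy_vectorHopping_add_le pairMap_knight01_injective (knightVec_mem_thicken_two 0)
      (knightVec_mem_thicken_two 1),
    hω.abs_meanEnergy_vectorHopping_add_le pairMap_knight23_injective (knightVec_mem_thicken_two 2)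
      (knightVec_mem_thicken_two 3)⟩

/-- **The total knight-move bond energy per site is bounded by `32/π²`** for every translation-invariant
state on `ℤ²`: `|Σ_{k<4} K_{knight k}(ω)| ≤ 32/π²` (two independent pairs; vs `4 · 2 = 8` from the norm).
[cite: LiebLoss1993, §8, Theorem 8.2] -/
theorem InfVolFermionState.IsTranslationInvariant.abs_sum_meanEnergy_knight_le {ω : InfVolFermionState 2}
    (hω : ω.IsTranslationInvariant) :
    |∑ k : Fin 4, ω.meanEnergy (vectorHoppingFermionInteraction 2 (knightVec k) 1) 2| ≤ 32 / Real.pi ^ 2 := by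
  obtain ⟨h01, h23⟩ := hω.abs_meanEnergy_knight_pairs_le
  rw [Fin.sum_univ_four,
    show ∀ a b c e : ℝ, a + b + c + e = (a + b) + (c + e) from fun a b c e => by ring]
  calc _ ≤ |ω.meanEnergy (vectorHoppingFermionInteraction 2 (knightVec 0) 1) 2 +
            ω.meanEnergy (vectorHoppingFermionInteraction 2 (knightVec 1) 1) 2| +
          |ω.meanEnergy (vectorHoppingFermionInteraction 2 (knightVec 2) 1) 2 +
            ω.meanEnergy (vectorHoppingFermionInteraction 2 (knightVec 3) 1) 2| := abs_add_le _ _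
    _ ≤ 16 / Real.pi ^ 2 + 16 / Real.pi ^ 2 := add_le_add h01 h23
    _ = 32 / Real.pi ^ 2 := by ring

/-- **The diagonal pair row through the dictionary**: `|K_{(1,1)}(ω) + K_{(1,−1)}(ω)| ≤ 16/π²`, i.e. the
tree's `K₂` row (`abs_meanEnergy_diagHop_le_of_any_density`, there via the checkerboard pullback) re-derived
from the pair row with `det((1,1),(1,−1)) = −2`. [cite: LiebLoss1993, §8, Theorem 8.2] -/
theorem InfVolFermionState.IsTranslationInvariant.abs_meanEnergy_diagVec_pair_le {ω : InfVolFermionState 2}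
    (hω : ω.IsTranslationInvariant) :
    |ω.meanEnergy (vectorHoppingFermionInteraction 2 (diagVec 0) 1) 1 +
        ω.meanEnergy (vectorHoppingFermionInteraction 2 (diagVec 1) 1) 1| ≤ 16 / Real.pi ^ 2 :=
  hω.abs_meanEnergy_vectorHopping_add_le
    (pairMap_injective_of_det_ne_zero (by simp [diagVec_apply_one]))
    (diagVec_mem_thicken_one 0) (diagVec_mem_thicken_one 1)

end Knight

end Literature.MathematicalPhysics.QuantumLattice

end
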